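import Literature.MathematicalPhysics.PowerSystems.DCFlowLineOutageUpdate
import HarnessLib

/-!
# DC power flow under a double line outage (N−2): the generalised LODF `K^F = D_{−F F}(I − D_{FF})⁻¹`
# for `|F| = 2` in closed form, and the islanding determinant
# `det(I − D_{FF}) = (1 − D₁₁)(1 − D₂₂) − D₁₂D₂₁ = (1 − b₁𝓡₁)(1 − b₂𝓡'₂) > 0 ⟺ F` is not a cut set

Topic `Literature/MathematicalPhysics/PowerSystems`; namespaces `…PowerSystems.KronReduction` (§1, the
determinant) and `…PowerSystems.ClassicalModel` (§2, the DC power-flow model).  Sixth file of the DC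
line-outage story (`DCFlowLineOutageFactor.lean`: transfer potentials `Lv = e_a − e_b`, `𝓡(a ↔ b) = v_a
− v_b`, reciprocity, PTDF `= b_mn(v_m − v_n)`, the single-outage LODF, `laplacian_lineOutage_eq`,
`isConductance_lineOutage`; `DCFlowLineOutageBounds.lean`: `b𝓡 = 1 ⟺` bridge, `b_mn|v_m − v_n| ≤ 1
− b_pq𝓡_pq`; `DCFlowLineOutageUpdate.lean`: post-outage resistances `𝓡' = 𝓡 + b(v_p − v_q)²/(1 −
b𝓡)`).  Everything below is PROVED: 0 definitions, 0 named facts, 0 `sorry`, no new axiom.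

SOURCES (read on the page).
* [GuoEtAl2020] L. Guo, C. Liang, A. Zocca, S. H. Low, A. Wierman, arXiv:2005.10199, §3.3.2 (p0008
  L68–L71): «Let `F ⊊ E` be a non-cut set of lines that are disconnected simultaneously … assume that
  the injections `p` remain unchanged»; (p0009 L15–L27): «`Δf_{−F} = K^F f_F` for non-cut set `F`» (the
  GLODF), «`K_{−FF} = D_{−FF}(I − diag(D_{FF}))⁻¹`»; **Theorem 7** (p0009 L32–L65): «Suppose a non-cut
  set `F ⊊ E` of lines trip simultaneously so that the surviving graph `(N, E∖F)` remains connected. …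
  `K^F = D_{−FF}(I − D_{FF})⁻¹` … The matrix `I − D_{FF}` is invertible provided `F` is a non-cut set of
  disconnected lines. … `K^F = K_{−FF}(I − diag(D_{FF}))(I − D_{FF})⁻¹`»; Example 1 (p0012 L80–L90):
  «Consider a non-cut set `F := {l₁, l₂}` and the N−2 event where lines `l₁` and `l₂` trip
  simultaneously. The branch flow change on a surviving line `l ∈ −F` is … `f̃_l − f_l = K^F_{l l₁}f_{l₁}
  + K^F_{l l₂}f_{l₂}`»; history (p0010 L1–L8): «[AlsacStottTinney1983] … matrix inversion lemma …
  [GulerGrossLiu2007] … emulate line outages through changes in injections on the pre-contingency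
  network by judiciously choosing injection at the tail of each disconnected line and withdrawal at its
  head … [GulerGross2007] uses the relation … to detect islanding: `F` is a cut set that disconnects
  the network if and only if the inverse in (GLODF) ceases to exist».
* [RonellenfitschEtAl2017] arXiv:1606.07276 §5.2 (p0008 L8–L24): «In case of a multiple line outages
  of lines `ℓ₁, …, ℓ_m` … Specifically, for the case of two failing lines, we obtain `ΔF_k = (M_{k,ℓ₁}
  M_{ℓ₂,ℓ₂} − M_{k,ℓ₂}M_{ℓ₂,ℓ₁})/(M_{ℓ₁,ℓ₁}M_{ℓ₂,ℓ₂} − M_{ℓ₁,ℓ₂}M_{ℓ₂,ℓ₁})·F_{ℓ₁} + (M_{k,ℓ₂}M_{ℓ₁,ℓ₁} −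
  M_{k,ℓ₁}M_{ℓ₁,ℓ₂})/(…)·F_{ℓ₂}`» (the same 2 × 2 Cramer structure in the dual variables).
* [StrakeEtAl2019] arXiv:1811.08683 §3.2–§3.3 (p0005): the single outage as the rank-one update `B +
  B_rs ν_rs ν_rsᵀ`, `B̂ψ = F_rs ν` (first file; iterated here).

RENDERING (as in the first file).  Conductance network `c` (`IsConductance c`), `L = diagonal
(nodeConductance c) − c`, graph hypothesis `hG : G.Adj x y ↔ x ≠ y ∧ c x y ≠ 0`, `G` connected.  The
two tripped lines are `ℓ₁ = {p,q}` and `ℓ₂ = {r,s}` (`p ≠ q`, `r ≠ s`, `c p q ≠ 0`, `c r s ≠ 0`,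
`s(r,s) ≠ s(p,q)`), `ν₁ = e_p − e_q`, `ν₂ = e_r − e_s`; `u`, `w` are transfer potentials of `ℓ₁`, `ℓ₂` on
the INTACT grid (`Lu = ν₁`, `Lw = ν₂`).  The 2 × 2 block `D_{FF}` of the transfer-factor (PTDF·K)
matrix is `D₁₁ = c(p,q)(u_p − u_q)` (`= c(p,q)𝓡(p ↔ q)`), `D₂₂ = c(r,s)(w_r − w_s)`, `D₁₂ = c(p,q)(w_p −
w_q)` (factor of line 1 for the transfer across line 2), `D₂₁ = c(r,s)(u_r − u_s)`; the ISLANDING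
DETERMINANT is `det(I − D_{FF}) = (1 − D₁₁)(1 − D₂₂) − D₁₂D₂₁`, written out in every statement.  The
damaged grids: `c₁` = `c` with `ℓ₁` deleted (`c₁ p q = c₁ q p = 0`, `= c` elsewhere, graph `G₁`), `c₂` =
`c₁` with `ℓ₂` deleted (graph `G₂` = the surviving graph `(N, E∖F)`); in §2 the post-contingency
Laplacian is the abstract `L''` with `hL'' : L'' = L − c p q • ν₁ν₁ᵀ − c r s • ν₂ν₂ᵀ`
(`laplacian_doubleOutage_eq` identifies it with the Laplacian of `c₂`).

WHAT IS PROVED (0 `def`, 0 named facts, 0 `sorry`).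
* §1 ★ `doubleOutage_det_eq_resistances` (`det = (1 − c_pq𝓡_pq)(1 − c_rs𝓡_rs) − c_pq c_rs(w_p − w_q)²`,
  reciprocity `D₁₂D₂₁ = c_pq c_rs (w_p − w_q)²`), ★★★ **`doubleOutage_det_eq_sequential`** (`det = (1 −
  c_pq𝓡(p ↔ q))·(1 − c_rs𝓡₁(r ↔ s))`, `𝓡₁` the resistance on the grid with `ℓ₁` removed: the N−2
  determinant factors into the two successive N−1 denominators), ★★★ **`doubleOutage_det_pos`**
  (surviving graph connected ⇒ `0 < det`), ★★ `doubleOutage_det_eq_zero_of_cut` (`ℓ₂` a bridge of the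
  grid without `ℓ₁` ⇒ `det = 0`), ★★ `doubleOutage_det_eq_zero_of_bridge₁` / `_of_bridge₂` (`ℓ₁` or `ℓ₂`
  a bridge of the intact grid ⇒ `det = 0`: then `D₂₁ = 0`, resp. `D₁₂ = 0`, by the `1 − b𝓡` bound on
  foreign transfer factors), ★★★ **`doubleOutage_det_pos_iff`** (ISLANDING TEST: `0 < det ⟺` the
  surviving graph is connected, and `0 ≤ det` always).
* §2 THE MODEL: ★ `laplacian_doubleOutage_eq` (`L₂ = L − c_pq ν₁ν₁ᵀ − c_rs ν₂ν₂ᵀ`), ★★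
  **`dcFlow_doubleOutage_transfer`** (`L(θ'' − θ) = f̃₁ν₁ + f̃₂ν₂` with the FICTITIOUS FLOWS `f̃₁ =
  c_pq(θ''_p − θ''_q)`, `f̃₂ = c_rs(θ''_r − θ''_s)` — «emulate line outages through changes in
  injections on the pre-contingency network»), ★★★ **`dcFlow_doubleOutage_selfConsistency`** (`(I −
  D_{FF})f̃ = f_F`: `(1 − D₁₁)f̃₁ − D₁₂f̃₂ = f₁`, `(1 − D₂₂)f̃₂ − D₂₁f̃₁ = f₂`), ★★★
  **`dcFlow_doubleOutage_flowChange`** (`ΔF_mn = D_{(mn),1}f̃₁ + D_{(mn),2}f̃₂` on every ordered pair),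
  ★★★ **`dcFlow_doubleOutage_glodf`** (CRAMER, division-free: `det·f̃₁ = (1 − D₂₂)f₁ + D₁₂f₂`, `det·f̃₂
  = D₂₁f₁ + (1 − D₁₁)f₂`, `det·ΔF_mn = D_{(mn),1}[(1 − D₂₂)f₁ + D₁₂f₂] + D_{(mn),2}[D₂₁f₁ + (1 − D₁₁)f₂]`
  — `K^F = D_{−FF}(I − D_{FF})⁻¹` multiplied through), ★★ `exists_dcFlow_doubleOutage` (surviving graph
  connected ⇒ a post-contingency operating point exists, unique up to the slack angle), ★★★
  **`dcFlow_doubleOutage`** (assembled, divided form: `0 < det` and `ΔF_mn = K_{(mn),1}f₁ +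
  K_{(mn),2}f₂` with `K_{(mn),1} = [D_{(mn),1}(1 − D₂₂) + D_{(mn),2}D₂₁]/det`, `K_{(mn),2} = [D_{(mn),1}D₁₂
  + D_{(mn),2}(1 − D₁₁)]/det`, for every post-contingency solution).

PROOF ROUTE.  §1: `D₁₁ = c𝓡_pq`, `D₂₂ = c𝓡_rs` (`effectiveResistance_eq_transferPotential_sub`),
`D₂₁ = c_rs(w_p − w_q)·(c_pq/c_pq)…` by reciprocity; the exact update `𝓡₁(r ↔ s) = 𝓡(r ↔ s) + c_pq(w_p −
w_q)²/(1 − c_pq𝓡_pq)` (`effectiveResistance_lineOutage_eq`) multiplied by `1 − c_pq𝓡_pq` is the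
factorisation; positivity from `conductance_mul_effectiveResistance_lt_one` on `c` and on `c₁`; the zero
cases from `conductance_mul_effectiveResistance_lt_one_iff_reachable` (`b𝓡 = 1` on bridges) and
`conductance_mul_transferPotential_sub_le` (a bridge's transfer puts no flow on other lines); the iff
sorts the cut cases (`ℓ₁` bridge; else `G₁ = G − ℓ₁` connected by Mathlib's
`Connected.connected_delete_edge_of_not_isBridge`, and `ℓ₂` bridge of `G₁` or `G₂ = G₁ − ℓ₂` connected).
§2: `L''θ'' = Lθ'' − c_pq(ν₁ᵀθ'')ν₁ − c_rs(ν₂ᵀθ'')ν₂`, so `L(θ'' − θ) = f̃₁ν₁ + f̃₂ν₂ = L(f̃₁u + f̃₂w)` and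
`θ'' − θ = f̃₁u + f̃₂w + κ𝟙` (`laplacian_mulVec_eq_mulVec_iff`); reading this on `ℓ₁`, `ℓ₂` gives `(I −
D_{FF})f̃ = f`, on `(m,n)` the flow change; Cramer is `ring`.  DECLARED DEVIATION: [GuoEtAl2020] prove
Theorem 7 through the post-contingency inverse `A_{−F}` and the matrix inversion lemma; here the
fictitious-injection route it attributes to [GulerGrossLiu2007] is made exact for `|F| = 2`, and the
invertibility statement is sharpened to the sign statement `det > 0 ⟺` non-cut (the determinant is a
product of two N−1 denominators).  In-seat exact cross-check (`negtest/dcflow_double_check.py`, python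
`Fraction`s): 70 random connected networks on 3–7 nodes, up to 14 random pairs of distinct lines as
`F` each: the two determinant identities, `det > 0 ⟺` surviving graph connected (graph search), `det
≥ 0` and `det = 0` on cut sets, the transfer identity, `(I − D_{FF})f̃ = f`, flow change, Cramer, the
division-free and divided GLODF on every ordered pair, and [GuoEtAl2020]'s relation `K^F = K_{−FF}(I −
diag(D_{FF}))(I − D_{FF})⁻¹`, all against DIRECT post-contingency solves — 41 314 checks, 0 failures.

THREE COLUMNS.  CERTIFIED (kernel theorems, exact data): the determinant identities, its sign
characterisation of islanding, the fictitious-flow equations, the N−2 flow change in division-free and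
divided GLODF form, existence of the post-contingency operating point.  MODELLED: DC (linearised,
lossless, `|V| ≈ 1`) power flow with fixed injections; two simultaneous line deletions with the surviving
graph connected; instantaneous redistribution, no dynamics / limits / protection / re-dispatch.
VALIDATED: nothing numerical in Lean.  NOT CLAIMED: `|F| ≥ 3` (general `(I − D_{FF})⁻¹`), Theorem 7's
post-contingency form `K^F = B_{−F}C_{−F}ᵀA_{−F}C_F` and the block-localisation Theorems 8–10 of
[GuoEtAl2020], the dual / cycle-flow formulas of [RonellenfitschEtAl2017], generator outages, AC power
flow.

## References
* [GuoEtAl2020] L. Guo, C. Liang, A. Zocca, S. H. Low, A. Wierman, *Line failure localization of power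
  networks, Part I: Non-cut outages*, IEEE Trans. Power Syst. 36 (2021), arXiv:2005.10199 — §3.3.2,
  Theorem 7, Example 1, historical notes (p0010).
* [RonellenfitschEtAl2017] H. Ronellenfitsch, D. Manik, J. Hörsch, T. Brown, D. Witthaut, *Dual theory
  of transmission line outages*, IEEE Trans. Power Syst. 32 (2017) 4060–4068, arXiv:1606.07276 — §5.2.
* [StrakeEtAl2019] J. Strake, F. Kaiser, F. Basiri, H. Ronellenfitsch, D. Witthaut, New J. Phys. 21
  (2019) 053009, arXiv:1811.08683 — §3.2–§3.3.
-/

noncomputable section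

open scoped Matrix
open Finset Matrix

namespace Literature.MathematicalPhysics.PowerSystems

namespace KronReduction

open Literature.Probability.MarkovChains

variable {X : Type*} [Fintype X] [DecidableEq X] {c : Matrix X X ℝ}

/-! ### §1. The islanding determinant `det(I − D_{FF}) = (1 − D₁₁)(1 − D₂₂) − D₁₂D₂₁` -/

section Det

omit [Fintype X] [DecidableEq X] in
/-- `s(r,s) ≠ s(p,q)` unfolded: `(r,s)` is neither `(p,q)` nor `(q,p)`. [folklore] -/
private theorem ne_line₁₈ {p q r s : X} (hne : s(r, s) ≠ s(p, q)) :
    ¬ (r = p ∧ s = q) ∧ ¬ (r = q ∧ s = p) := by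
  rw [Ne, Sym2.eq_iff] at hne
  exact not_or.1 hne

/-- ★ **THE DETERMINANT THROUGH RESISTANCES**: `det(I − D_{FF}) = (1 − c(p,q)𝓡(p ↔ q))(1 −
c(r,s)𝓡(r ↔ s)) − c(p,q)c(r,s)(w_p − w_q)²` — the diagonal factors are the self-factors `b𝓡`, and
`D₁₂D₂₁ = c_pq c_rs(w_p − w_q)²` by reciprocity (`u_r − u_s = w_p − w_q`).
[cite: GuoEtAl2020, §3.3.2 Theorem 7 (`I − D_{FF}`, arXiv:2005.10199 p0009 L46–L60), §3.2 (`D_{ll} = B_{ll}(R)`, p0008)] -/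
theorem doubleOutage_det_eq_resistances (hc : IsConductance c) {G : SimpleGraph X}
    (hG : ∀ x y, G.Adj x y ↔ x ≠ y ∧ c x y ≠ 0) (hconn : G.Connected) {p q r s : X} (hpq : p ≠ q)
    (hrs : r ≠ s) {u w : X → ℝ}
    (hu : (Matrix.diagonal (nodeConductance c) - c) *ᵥ u = Pi.single p 1 - Pi.single q 1)
    (hw : (Matrix.diagonal (nodeConductance c) - c) *ᵥ w = Pi.single r 1 - Pi.single s 1) :
    (1 - c p q * (u p - u q)) * (1 - c r s * (w r - w s)) - (c p q * (w p - w q)) * (c r s * (u r - u s))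
      = (1 - c p q * effectiveResistance c p q) * (1 - c r s * effectiveResistance c r s)
        - c p q * c r s * (w p - w q) ^ 2 := by
  rw [← effectiveResistance_eq_transferPotential_sub hc hG hconn hpq hu,
    ← effectiveResistance_eq_transferPotential_sub hc hG hconn hrs hw,
    ← transferPotential_reciprocity hc hw hu]
  ring

/-- ★★★ **THE N−2 DETERMINANT IS THE PRODUCT OF TWO SUCCESSIVE N−1 DENOMINATORS**: if the grid `c₁`
without `ℓ₁ = {p,q}` is connected, then `det(I − D_{FF}) = (1 − c(p,q)𝓡(p ↔ q))·(1 − c(r,s)𝓡₁(r ↔ s))`,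
`𝓡₁` the effective resistance on `c₁` — trip `ℓ₁` first (denominator `1 − D₁₁`), then `ℓ₂` on the
damaged grid (denominator `1 − b₂𝓡₁(ℓ₂)`, with `𝓡₁(r ↔ s) = 𝓡(r ↔ s) + c_pq(w_p − w_q)²/(1 − c_pq𝓡_pq)`).
[cite: GuoEtAl2020, §3.3.2 Theorem 7 and eq. `K^F = K_{−FF}(I − diag(D_{FF}))(I − D_{FF})⁻¹` (arXiv:2005.10199 p0009 L32–L65); DorflerBullo2013, §3.4 Theorem 3.15 2) (the resistance update, arXiv:1102.2950 p0020 L38–L46)] -/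
theorem doubleOutage_det_eq_sequential (hc : IsConductance c) {G : SimpleGraph X}
    (hG : ∀ x y, G.Adj x y ↔ x ≠ y ∧ c x y ≠ 0) (hconn : G.Connected) {p q r s : X} (hpq : p ≠ q)
    (hcpq : c p q ≠ 0) (hrs : r ≠ s) {c₁ : Matrix X X ℝ} (h₁pq : c₁ p q = 0) (h₁qp : c₁ q p = 0)
    (hoff₁ : ∀ x y, ¬ (x = p ∧ y = q) → ¬ (x = q ∧ y = p) → c₁ x y = c x y)
    {G₁ : SimpleGraph X} (hG₁ : ∀ x y, G₁.Adj x y ↔ x ≠ y ∧ c₁ x y ≠ 0) (hconn₁ : G₁.Connected)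
    {u w : X → ℝ}
    (hu : (Matrix.diagonal (nodeConductance c) - c) *ᵥ u = Pi.single p 1 - Pi.single q 1)
    (hw : (Matrix.diagonal (nodeConductance c) - c) *ᵥ w = Pi.single r 1 - Pi.single s 1) :
    (1 - c p q * (u p - u q)) * (1 - c r s * (w r - w s)) - (c p q * (w p - w q)) * (c r s * (u r - u s))
      = (1 - c p q * effectiveResistance c p q) * (1 - c r s * effectiveResistance c₁ r s) := by
  obtain ⟨hpos, hR₁, -, -⟩ :=
    effectiveResistance_lineOutage_eq hc hG hconn hpq hcpq h₁pq h₁qp hoff₁ hG₁ hconn₁ hrs hw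
  have hne : 1 - c p q * effectiveResistance c p q ≠ 0 := hpos.ne'
  rw [doubleOutage_det_eq_resistances hc hG hconn hpq hrs hu hw, hR₁]
  have hkey : (1 - c p q * effectiveResistance c p q)
      * (c p q * (w p - w q) ^ 2 / (1 - c p q * effectiveResistance c p q)) = c p q * (w p - w q) ^ 2 := by
    rw [mul_div_assoc', mul_div_cancel_left₀ _ hne]
  linear_combination (c r s) * hkey

omit [Fintype X] [DecidableEq X] in
/-- The surviving graph is a subgraph of the grid without `ℓ₁`; lines of `c₂` are lines of `c₁` other
than `ℓ₂`. [folklore] -/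
private theorem surviving_sub₁₈ {r s : X} {c₁ c₂ : Matrix X X ℝ} (h₂rs : c₂ r s = 0)
    (h₂sr : c₂ s r = 0) (hoff₂ : ∀ x y, ¬ (x = r ∧ y = s) → ¬ (x = s ∧ y = r) → c₂ x y = c₁ x y)
    {G₁ : SimpleGraph X} (hG₁ : ∀ x y, G₁.Adj x y ↔ x ≠ y ∧ c₁ x y ≠ 0)
    {G₂ : SimpleGraph X} (hG₂ : ∀ x y, G₂.Adj x y ↔ x ≠ y ∧ c₂ x y ≠ 0) :
    G₂ ≤ G₁ ∧ ∀ x y, G₂.Adj x y → c₁ x y ≠ 0 ∧ ¬ (x = r ∧ y = s) ∧ ¬ (x = s ∧ y = r) := by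
  have key : ∀ x y, G₂.Adj x y → c₁ x y ≠ 0 ∧ ¬ (x = r ∧ y = s) ∧ ¬ (x = s ∧ y = r) := by
    intro x y hxy
    obtain ⟨-, hc₂⟩ := (hG₂ x y).1 hxy
    have h1 : ¬ (x = r ∧ y = s) := fun h => hc₂ (by rw [h.1, h.2, h₂rs])
    have h2 : ¬ (x = s ∧ y = r) := fun h => hc₂ (by rw [h.1, h.2, h₂sr])
    exact ⟨by rwa [hoff₂ x y h1 h2] at hc₂, h1, h2⟩
  exact ⟨fun x y hxy => (hG₁ x y).2 ⟨((hG₂ x y).1 hxy).1, (key x y hxy).1⟩, key⟩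

/-- ★★★ **NON-CUT ⇒ POSITIVE DETERMINANT**: if the surviving graph `G₂` (both lines deleted) is
connected, then `det(I − D_{FF}) > 0` — both successive denominators are positive («The matrix `I −
D_{FF}` is invertible provided `F` is a non-cut set»).
[cite: GuoEtAl2020, §3.3.2 Theorem 7 (arXiv:2005.10199 p0009 L34, L58–L60)] -/
theorem doubleOutage_det_pos (hc : IsConductance c) {G : SimpleGraph X}
    (hG : ∀ x y, G.Adj x y ↔ x ≠ y ∧ c x y ≠ 0) (hconn : G.Connected) {p q r s : X} (hpq : p ≠ q)
    (hcpq : c p q ≠ 0) (hrs : r ≠ s) (hcrs : c r s ≠ 0) (hne : s(r, s) ≠ s(p, q))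
    {c₁ : Matrix X X ℝ} (h₁pq : c₁ p q = 0) (h₁qp : c₁ q p = 0)
    (hoff₁ : ∀ x y, ¬ (x = p ∧ y = q) → ¬ (x = q ∧ y = p) → c₁ x y = c x y)
    {G₁ : SimpleGraph X} (hG₁ : ∀ x y, G₁.Adj x y ↔ x ≠ y ∧ c₁ x y ≠ 0)
    {c₂ : Matrix X X ℝ} (h₂rs : c₂ r s = 0) (h₂sr : c₂ s r = 0)
    (hoff₂ : ∀ x y, ¬ (x = r ∧ y = s) → ¬ (x = s ∧ y = r) → c₂ x y = c₁ x y)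
    {G₂ : SimpleGraph X} (hG₂ : ∀ x y, G₂.Adj x y ↔ x ≠ y ∧ c₂ x y ≠ 0) (hconn₂ : G₂.Connected)
    {u w : X → ℝ}
    (hu : (Matrix.diagonal (nodeConductance c) - c) *ᵥ u = Pi.single p 1 - Pi.single q 1)
    (hw : (Matrix.diagonal (nodeConductance c) - c) *ᵥ w = Pi.single r 1 - Pi.single s 1) :
    0 < (1 - c p q * (u p - u q)) * (1 - c r s * (w r - w s))
        - (c p q * (w p - w q)) * (c r s * (u r - u s)) := by
  obtain ⟨hle, hG₂w⟩ := surviving_sub₁₈ h₂rs h₂sr hoff₂ hG₁ hG₂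
  have hconn₁ : G₁.Connected := hconn₂.mono hle
  have hc₁ := ClassicalModel.isConductance_lineOutage hc hpq h₁pq h₁qp hoff₁ hG₁ hconn₁
  obtain ⟨h1, h2⟩ := ne_line₁₈ hne
  have h₁rs : c₁ r s = c r s := hoff₁ r s h1 h2
  obtain ⟨hpos, -⟩ :=
    effectiveResistance_lineOutage_eq hc hG hconn hpq hcpq h₁pq h₁qp hoff₁ hG₁ hconn₁ hrs hw
  rw [doubleOutage_det_eq_sequential hc hG hconn hpq hcpq hrs h₁pq h₁qp hoff₁ hG₁ hconn₁ hu hw]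
  refine mul_pos hpos (sub_pos.2 ?_)
  rw [← h₁rs]
  exact conductance_mul_effectiveResistance_lt_one hc₁ hG₁ hconn₁ hrs (by rwa [h₁rs]) hG₂w
    (hconn₂.preconnected r s)

/-- ★★ **CUT ⇒ ZERO DETERMINANT, I**: if `ℓ₁` is not a bridge (grid `c₁` without it connected) but
`ℓ₂` is a bridge of that damaged grid, then `det(I − D_{FF}) = 0` (the second denominator vanishes:
`b₂𝓡₁(ℓ₂) = 1`).
[cite: GuoEtAl2020, §3.3.2 Theorem 7 and the note on [GulerGross2007] («`F` is a cut set … if and only if the inverse … ceases to exist», arXiv:2005.10199 p0009 L58–L60, p0010 L6–L7)] -/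
theorem doubleOutage_det_eq_zero_of_cut (hc : IsConductance c) {G : SimpleGraph X}
    (hG : ∀ x y, G.Adj x y ↔ x ≠ y ∧ c x y ≠ 0) (hconn : G.Connected) {p q r s : X} (hpq : p ≠ q)
    (hcpq : c p q ≠ 0) (hrs : r ≠ s) (hcrs : c r s ≠ 0) (hne : s(r, s) ≠ s(p, q))
    {c₁ : Matrix X X ℝ} (h₁pq : c₁ p q = 0) (h₁qp : c₁ q p = 0)
    (hoff₁ : ∀ x y, ¬ (x = p ∧ y = q) → ¬ (x = q ∧ y = p) → c₁ x y = c x y)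
    {G₁ : SimpleGraph X} (hG₁ : ∀ x y, G₁.Adj x y ↔ x ≠ y ∧ c₁ x y ≠ 0) (hconn₁ : G₁.Connected)
    (hcut : ¬ (G₁.deleteEdges {s(r, s)}).Reachable r s) {u w : X → ℝ}
    (hu : (Matrix.diagonal (nodeConductance c) - c) *ᵥ u = Pi.single p 1 - Pi.single q 1)
    (hw : (Matrix.diagonal (nodeConductance c) - c) *ᵥ w = Pi.single r 1 - Pi.single s 1) :
    (1 - c p q * (u p - u q)) * (1 - c r s * (w r - w s)) - (c p q * (w p - w q)) * (c r s * (u r - u s))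
      = 0 := by
  have hc₁ := ClassicalModel.isConductance_lineOutage hc hpq h₁pq h₁qp hoff₁ hG₁ hconn₁
  obtain ⟨h1, h2⟩ := ne_line₁₈ hne
  have h₁rs : c₁ r s = c r s := hoff₁ r s h1 h2
  have hone : c₁ r s * effectiveResistance c₁ r s = 1 :=
    (conductance_mul_effectiveResistance_lt_one_iff_reachable hc₁ hG₁ hconn₁ hrs (by rwa [h₁rs])).2.2
      hcut
  rw [doubleOutage_det_eq_sequential hc hG hconn hpq hcpq hrs h₁pq h₁qp hoff₁ hG₁ hconn₁ hu hw, ← h₁rs,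
    hone, sub_self, mul_zero]

/-- ★★ **CUT ⇒ ZERO DETERMINANT, II**: if `ℓ₂` is a bridge of the INTACT grid then `det(I − D_{FF}) = 0`:
`1 − D₂₂ = 1 − b₂𝓡₂ = 0`, and `D₁₂ = 0` because the transfer across a bridge puts no flow on any other
line (`b_mn|w_m − w_n| ≤ 1 − b₂𝓡₂ = 0`).
[cite: GuoEtAl2020, §3.3.2 (arXiv:2005.10199 p0010 L6–L7: «`F` is a cut set that disconnects the network if and only if the inverse … ceases to exist»), §3.2 Corollary 5 (p0008)] -/
theorem doubleOutage_det_eq_zero_of_bridge₂ (hc : IsConductance c) {G : SimpleGraph X}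
    (hG : ∀ x y, G.Adj x y ↔ x ≠ y ∧ c x y ≠ 0) (hconn : G.Connected) {p q r s : X}
    (hrs : r ≠ s) (hcrs : c r s ≠ 0) (hne : s(r, s) ≠ s(p, q)) {u w : X → ℝ}
    (hw : (Matrix.diagonal (nodeConductance c) - c) *ᵥ w = Pi.single r 1 - Pi.single s 1)
    (hbr : ¬ (G.deleteEdges {s(r, s)}).Reachable r s) :
    (1 - c p q * (u p - u q)) * (1 - c r s * (w r - w s)) - (c p q * (w p - w q)) * (c r s * (u r - u s))
      = 0 := by
  have hone : c r s * effectiveResistance c r s = 1 :=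
    (conductance_mul_effectiveResistance_lt_one_iff_reachable hc hG hconn hrs hcrs).2.2 hbr
  have hD22 : c r s * (w r - w s) = 1 := by
    rw [← effectiveResistance_eq_transferPotential_sub hc hG hconn hrs hw, hone]
  obtain ⟨h1, h2⟩ := ne_line₁₈ hne
  have h1' : ¬ (p = r ∧ q = s) := fun h => h1 ⟨h.1.symm, h.2.symm⟩
  have h2' : ¬ (p = s ∧ q = r) := fun h => h2 ⟨h.2.symm, h.1.symm⟩
  have hle := conductance_mul_transferPotential_sub_le hc hG hconn hrs hw h1' h2'
  rw [hone, sub_self] at hle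
  have hD12 : c p q * (w p - w q) = 0 := by
    have h0 : c p q * |w p - w q| = 0 :=
      le_antisymm hle (mul_nonneg (hc.nonneg p q) (abs_nonneg _))
    rcases mul_eq_zero.1 h0 with h | h
    · rw [h, zero_mul]
    · rw [abs_eq_zero.1 h, mul_zero]
  rw [hD22, hD12, sub_self, mul_zero, zero_mul, sub_self]

/-- ★★ **CUT ⇒ ZERO DETERMINANT, III**: symmetrically, if `ℓ₁` is a bridge of the intact grid then
`det(I − D_{FF}) = 0` (`1 − D₁₁ = 0` and `D₂₁ = 0`).
[cite: GuoEtAl2020, §3.3.2 (arXiv:2005.10199 p0010 L6–L7), §3.2 Corollary 5 (p0008)] -/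
theorem doubleOutage_det_eq_zero_of_bridge₁ (hc : IsConductance c) {G : SimpleGraph X}
    (hG : ∀ x y, G.Adj x y ↔ x ≠ y ∧ c x y ≠ 0) (hconn : G.Connected) {p q r s : X}
    (hpq : p ≠ q) (hcpq : c p q ≠ 0) (hne : s(r, s) ≠ s(p, q)) {u w : X → ℝ}
    (hu : (Matrix.diagonal (nodeConductance c) - c) *ᵥ u = Pi.single p 1 - Pi.single q 1)
    (hbr : ¬ (G.deleteEdges {s(p, q)}).Reachable p q) :
    (1 - c p q * (u p - u q)) * (1 - c r s * (w r - w s)) - (c p q * (w p - w q)) * (c r s * (u r - u s))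
      = 0 := by
  have hone : c p q * effectiveResistance c p q = 1 :=
    (conductance_mul_effectiveResistance_lt_one_iff_reachable hc hG hconn hpq hcpq).2.2 hbr
  have hD11 : c p q * (u p - u q) = 1 := by
    rw [← effectiveResistance_eq_transferPotential_sub hc hG hconn hpq hu, hone]
  obtain ⟨h1, h2⟩ := ne_line₁₈ hne
  have hle := conductance_mul_transferPotential_sub_le hc hG hconn hpq hu h1 h2
  rw [hone, sub_self] at hle
  have hD21 : c r s * (u r - u s) = 0 := by
    have h0 : c r s * |u r - u s| = 0 :=
      le_antisymm hle (mul_nonneg (hc.nonneg r s) (abs_nonneg _))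
    rcases mul_eq_zero.1 h0 with h | h
    · rw [h, zero_mul]
    · rw [abs_eq_zero.1 h, mul_zero]
  rw [hD11, hD21, sub_self, zero_mul, mul_zero, sub_self]

/-- ★★★ **THE ISLANDING TEST**: with `c₁ = c − ℓ₁`, `c₂ = c₁ − ℓ₂` and their graphs `G₁`, `G₂` (no
connectivity assumed), `det(I − D_{FF}) > 0 ⟺` the surviving graph `G₂` is connected, and `det(I −
D_{FF}) ≥ 0` always («`F` is a cut set that disconnects the network if and only if the inverse in
(GLODF) ceases to exist» — for `|F| = 2`, with the sign).
[cite: GuoEtAl2020, §3.3.2 Theorem 7 and the note on [GulerGross2007] (arXiv:2005.10199 p0009 L58–L60, p0010 L6–L7)] -/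
theorem doubleOutage_det_pos_iff (hc : IsConductance c) {G : SimpleGraph X}
    (hG : ∀ x y, G.Adj x y ↔ x ≠ y ∧ c x y ≠ 0) (hconn : G.Connected) {p q r s : X} (hpq : p ≠ q)
    (hcpq : c p q ≠ 0) (hrs : r ≠ s) (hcrs : c r s ≠ 0) (hne : s(r, s) ≠ s(p, q))
    {c₁ : Matrix X X ℝ} (h₁pq : c₁ p q = 0) (h₁qp : c₁ q p = 0)
    (hoff₁ : ∀ x y, ¬ (x = p ∧ y = q) → ¬ (x = q ∧ y = p) → c₁ x y = c x y)
    {G₁ : SimpleGraph X} (hG₁ : ∀ x y, G₁.Adj x y ↔ x ≠ y ∧ c₁ x y ≠ 0)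
    {c₂ : Matrix X X ℝ} (h₂rs : c₂ r s = 0) (h₂sr : c₂ s r = 0)
    (hoff₂ : ∀ x y, ¬ (x = r ∧ y = s) → ¬ (x = s ∧ y = r) → c₂ x y = c₁ x y)
    {G₂ : SimpleGraph X} (hG₂ : ∀ x y, G₂.Adj x y ↔ x ≠ y ∧ c₂ x y ≠ 0) {u w : X → ℝ}
    (hu : (Matrix.diagonal (nodeConductance c) - c) *ᵥ u = Pi.single p 1 - Pi.single q 1)
    (hw : (Matrix.diagonal (nodeConductance c) - c) *ᵥ w = Pi.single r 1 - Pi.single s 1) :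
    (0 < (1 - c p q * (u p - u q)) * (1 - c r s * (w r - w s))
        - (c p q * (w p - w q)) * (c r s * (u r - u s)) ↔ G₂.Connected)
    ∧ 0 ≤ (1 - c p q * (u p - u q)) * (1 - c r s * (w r - w s))
        - (c p q * (w p - w q)) * (c r s * (u r - u s)) := by
  classical
  obtain ⟨h1, h2⟩ := ne_line₁₈ hne
  -- the graphs `G₁`, `G₂` are the edge-deleted graphs
  have hG₁eq : G₁ = G.deleteEdges {s(p, q)} := by
    ext x y
    rw [hG₁, SimpleGraph.deleteEdges_adj, hG, Set.mem_singleton_iff, Sym2.eq_iff]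
    constructor
    · rintro ⟨hxy, hc₁⟩
      have ha : ¬ (x = p ∧ y = q) := fun h => hc₁ (by rw [h.1, h.2, h₁pq])
      have hb : ¬ (x = q ∧ y = p) := fun h => hc₁ (by rw [h.1, h.2, h₁qp])
      exact ⟨⟨hxy, by rwa [hoff₁ x y ha hb] at hc₁⟩, not_or.2 ⟨ha, hb⟩⟩
    · rintro ⟨⟨hxy, hcxy⟩, hn⟩
      obtain ⟨ha, hb⟩ := not_or.1 hn
      exact ⟨hxy, by rwa [hoff₁ x y ha hb]⟩
  have hG₂eq : G₂ = G₁.deleteEdges {s(r, s)} := by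
    ext x y
    rw [hG₂, SimpleGraph.deleteEdges_adj, hG₁, Set.mem_singleton_iff, Sym2.eq_iff]
    constructor
    · rintro ⟨hxy, hc₂⟩
      have ha : ¬ (x = r ∧ y = s) := fun h => hc₂ (by rw [h.1, h.2, h₂rs])
      have hb : ¬ (x = s ∧ y = r) := fun h => hc₂ (by rw [h.1, h.2, h₂sr])
      exact ⟨⟨hxy, by rwa [hoff₂ x y ha hb] at hc₂⟩, not_or.2 ⟨ha, hb⟩⟩
    · rintro ⟨⟨hxy, hcxy⟩, hn⟩
      obtain ⟨ha, hb⟩ := not_or.1 hn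
      exact ⟨hxy, by rwa [hoff₂ x y ha hb]⟩
  have key : ¬ G₂.Connected →
      (1 - c p q * (u p - u q)) * (1 - c r s * (w r - w s))
        - (c p q * (w p - w q)) * (c r s * (u r - u s)) = 0 := by
    intro hnc
    by_cases hb₁ : (G.deleteEdges {s(p, q)}).Reachable p q
    · have hconn₁ : G₁.Connected := by
        rw [hG₁eq]
        exact hconn.connected_delete_edge_of_not_isBridge (by rwa [SimpleGraph.isBridge_iff, not_not])
      by_cases hb₂ : (G₁.deleteEdges {s(r, s)}).Reachable r s
      · exact absurd (by
          rw [hG₂eq]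
          exact hconn₁.connected_delete_edge_of_not_isBridge
            (by rwa [SimpleGraph.isBridge_iff, not_not])) hnc
      · exact doubleOutage_det_eq_zero_of_cut hc hG hconn hpq hcpq hrs hcrs hne h₁pq h₁qp hoff₁ hG₁
          hconn₁ hb₂ hu hw
    · exact doubleOutage_det_eq_zero_of_bridge₁ hc hG hconn hpq hcpq hne hu hb₁
  have hposdir : G₂.Connected → 0 < (1 - c p q * (u p - u q)) * (1 - c r s * (w r - w s))
      - (c p q * (w p - w q)) * (c r s * (u r - u s)) := fun hconn₂ =>
    doubleOutage_det_pos hc hG hconn hpq hcpq hrs hcrs hne h₁pq h₁qp hoff₁ hG₁ h₂rs h₂sr hoff₂ hG₂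
      hconn₂ hu hw
  refine ⟨⟨fun hpos => ?_, hposdir⟩, ?_⟩
  · by_contra hnc
    have := key hnc
    linarith
  · by_cases hconn₂ : G₂.Connected
    · exact (hposdir hconn₂).le
    · exact (key hconn₂).ge

end Det

end KronReduction

/-! ### §2. THE MODEL: DC power flow with two lines tripped — fictitious flows, `(I − D_{FF})f̃ = f_F`,
and the generalised LODF for `|F| = 2` -/

namespace ClassicalModel

open KronReduction Literature.Probability.MarkovChains

variable {X : Type*} [Fintype X] [DecidableEq X] {c : Matrix X X ℝ}

/-- `ν_abᵀθ = θ_a − θ_b`. [folklore] -/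
private theorem nu_dotProduct₁₈ (a b : X) (θ : X → ℝ) :
    (Pi.single a (1 : ℝ) - Pi.single b 1) ⬝ᵥ θ = θ a - θ b := by
  rw [sub_dotProduct, single_one_dotProduct, single_one_dotProduct]

/-- `(w·ννᵀ)θ = w(θ_a − θ_b)·ν`. [folklore] -/
private theorem rankOne_mulVec₁₈ (a b : X) (w : ℝ) (θ : X → ℝ) :
    (w • Matrix.vecMulVec (Pi.single a (1 : ℝ) - Pi.single b 1) (Pi.single a (1 : ℝ) - Pi.single b 1)) *ᵥ θ
      = (w * (θ a - θ b)) • (Pi.single a (1 : ℝ) - Pi.single b 1) := by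
  funext x
  rw [Matrix.smul_mulVec, Pi.smul_apply, Pi.smul_apply, smul_eq_mul, smul_eq_mul, Matrix.mulVec,
    dotProduct]
  simp_rw [Matrix.vecMulVec_apply, mul_assoc, ← Finset.mul_sum]
  rw [← dotProduct, nu_dotProduct₁₈]
  ring

/-- ★ **TWO OUTAGES = TWO RANK-ONE UPDATES**: if `c₁` is `c` without `ℓ₁ = {p,q}` and `c₂` is `c₁`
without `ℓ₂ = {r,s}` (`ℓ₂ ≠ ℓ₁`), then the Laplacian of `c₂` is `L − c(p,q)ν₁ν₁ᵀ − c(r,s)ν₂ν₂ᵀ`.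
[cite: StrakeEtAl2019, §3.2 eq. (8) (arXiv:1811.08683 p0005 L47–L52); GuoEtAl2020, §3.3.2 (`L_{−F} = C_{−F}B_{−F}C_{−F}ᵀ`, arXiv:2005.10199 p0009 L28–L30)] -/
theorem laplacian_doubleOutage_eq (hc : IsConductance c) {p q r s : X} (hpq : p ≠ q) (hrs : r ≠ s)
    (hne : s(r, s) ≠ s(p, q)) {c₁ : Matrix X X ℝ} (h₁pq : c₁ p q = 0) (h₁qp : c₁ q p = 0)
    (hoff₁ : ∀ x y, ¬ (x = p ∧ y = q) → ¬ (x = q ∧ y = p) → c₁ x y = c x y)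
    {G₁ : SimpleGraph X} (hG₁ : ∀ x y, G₁.Adj x y ↔ x ≠ y ∧ c₁ x y ≠ 0) (hconn₁ : G₁.Connected)
    {c₂ : Matrix X X ℝ} (h₂rs : c₂ r s = 0) (h₂sr : c₂ s r = 0)
    (hoff₂ : ∀ x y, ¬ (x = r ∧ y = s) → ¬ (x = s ∧ y = r) → c₂ x y = c₁ x y) :
    Matrix.diagonal (nodeConductance c₂) - c₂
      = (Matrix.diagonal (nodeConductance c) - c)
        - c p q • Matrix.vecMulVec (Pi.single p (1 : ℝ) - Pi.single q 1) (Pi.single p (1 : ℝ) - Pi.single q 1)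
        - c r s • Matrix.vecMulVec (Pi.single r (1 : ℝ) - Pi.single s 1) (Pi.single r (1 : ℝ) - Pi.single s 1) := by
  have hc₁ := isConductance_lineOutage hc hpq h₁pq h₁qp hoff₁ hG₁ hconn₁
  rw [Ne, Sym2.eq_iff, not_or] at hne
  rw [laplacian_lineOutage_eq hc₁ hrs h₂rs h₂sr hoff₂, laplacian_lineOutage_eq hc hpq h₁pq h₁qp hoff₁,
    hoff₁ r s hne.1 hne.2]

/-- ★★ **THE ANGLE CHANGE IS A SUPERPOSITION OF THE TWO TRANSFERS**: with `Lθ = P` before and `L''θ''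
= P` after (`L'' = L − c_pqν₁ν₁ᵀ − c_rsν₂ν₂ᵀ`), the change `ψ = θ'' − θ` satisfies, on the INTACT grid,
`Lψ = f̃₁ν₁ + f̃₂ν₂` with the fictitious flows `f̃₁ = c(p,q)(θ''_p − θ''_q)`, `f̃₂ = c(r,s)(θ''_r − θ''_s)`
(the tripped lines' susceptances times the POST-contingency angle differences) — «emulate line
outages through changes in injections on the pre-contingency network by judiciously choosing
injection at the tail of each disconnected line and withdrawal at its head».
[cite: GuoEtAl2020, §3.3.2 and the note on [GulerGrossLiu2007] (arXiv:2005.10199 p0010 L5–L6); StrakeEtAl2019, §3.3 eqs. (11)–(12) (one line, arXiv:1811.08683 p0005 L89–L96)] -/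
theorem dcFlow_doubleOutage_transfer {p q r s : X} {L'' : Matrix X X ℝ}
    (hL'' : L'' = (Matrix.diagonal (nodeConductance c) - c)
        - c p q • Matrix.vecMulVec (Pi.single p (1 : ℝ) - Pi.single q 1) (Pi.single p (1 : ℝ) - Pi.single q 1)
        - c r s • Matrix.vecMulVec (Pi.single r (1 : ℝ) - Pi.single s 1) (Pi.single r (1 : ℝ) - Pi.single s 1))
    {P θ θ'' : X → ℝ} (hθ : (Matrix.diagonal (nodeConductance c) - c) *ᵥ θ = P) (hθ'' : L'' *ᵥ θ'' = P) :
    (Matrix.diagonal (nodeConductance c) - c) *ᵥ (θ'' - θ)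
      = (c p q * (θ'' p - θ'' q)) • (Pi.single p (1 : ℝ) - Pi.single q 1)
        + (c r s * (θ'' r - θ'' s)) • (Pi.single r (1 : ℝ) - Pi.single s 1) := by
  have h1 : (Matrix.diagonal (nodeConductance c) - c) *ᵥ θ''
      = P + (c p q * (θ'' p - θ'' q)) • (Pi.single p (1 : ℝ) - Pi.single q 1)
          + (c r s * (θ'' r - θ'' s)) • (Pi.single r (1 : ℝ) - Pi.single s 1) := by
    have := hθ''
    rw [hL'', Matrix.sub_mulVec, Matrix.sub_mulVec, rankOne_mulVec₁₈, rankOne_mulVec₁₈] at this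
    rw [← this]
    abel
  rw [Matrix.mulVec_sub, h1, hθ]
  abel

/-- ★★★ **SELF-CONSISTENCY OF THE FICTITIOUS FLOWS: `(I − D_{FF})f̃ = f_F`.**  With `u`, `w` transfer
potentials of `ℓ₁`, `ℓ₂` on the intact grid, `f₁ = c(p,q)(θ_p − θ_q)`, `f₂ = c(r,s)(θ_r − θ_s)` the
pre-contingency flows and `f̃₁`, `f̃₂` as above:
`(1 − D₁₁)f̃₁ − D₁₂f̃₂ = f₁` and `(1 − D₂₂)f̃₂ − D₂₁f̃₁ = f₂`.
[cite: GuoEtAl2020, §3.3.2 Theorem 7 (`K^F = D_{−FF}(I − D_{FF})⁻¹`, arXiv:2005.10199 p0009 L42–L48), p0010 L5–L6 ([GulerGrossLiu2007]'s injections)] -/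
theorem dcFlow_doubleOutage_selfConsistency (hc : IsConductance c) {G : SimpleGraph X}
    (hG : ∀ x y, G.Adj x y ↔ x ≠ y ∧ c x y ≠ 0) (hconn : G.Connected) {p q r s : X}
    {L'' : Matrix X X ℝ}
    (hL'' : L'' = (Matrix.diagonal (nodeConductance c) - c)
        - c p q • Matrix.vecMulVec (Pi.single p (1 : ℝ) - Pi.single q 1) (Pi.single p (1 : ℝ) - Pi.single q 1)
        - c r s • Matrix.vecMulVec (Pi.single r (1 : ℝ) - Pi.single s 1) (Pi.single r (1 : ℝ) - Pi.single s 1))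
    {P θ θ'' u w : X → ℝ} (hθ : (Matrix.diagonal (nodeConductance c) - c) *ᵥ θ = P)
    (hθ'' : L'' *ᵥ θ'' = P)
    (hu : (Matrix.diagonal (nodeConductance c) - c) *ᵥ u = Pi.single p 1 - Pi.single q 1)
    (hw : (Matrix.diagonal (nodeConductance c) - c) *ᵥ w = Pi.single r 1 - Pi.single s 1) :
    (1 - c p q * (u p - u q)) * (c p q * (θ'' p - θ'' q)) - (c p q * (w p - w q)) * (c r s * (θ'' r - θ'' s))
        = c p q * (θ p - θ q)
    ∧ (1 - c r s * (w r - w s)) * (c r s * (θ'' r - θ'' s)) - (c r s * (u r - u s)) * (c p q * (θ'' p - θ'' q))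
        = c r s * (θ r - θ s) := by
  have h1 := dcFlow_doubleOutage_transfer hL'' hθ hθ''
  have h2 : (Matrix.diagonal (nodeConductance c) - c) *ᵥ (θ'' - θ)
      = (Matrix.diagonal (nodeConductance c) - c) *ᵥ
          ((c p q * (θ'' p - θ'' q)) • u + (c r s * (θ'' r - θ'' s)) • w) := by
    rw [Matrix.mulVec_add, Matrix.mulVec_smul, Matrix.mulVec_smul, hu, hw, h1]
  obtain ⟨κ, hκ⟩ := (laplacian_mulVec_eq_mulVec_iff hc hG hconn _ _).1 h2.symm
  have hp := hκ p
  have hq := hκ q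
  have hr := hκ r
  have hs := hκ s
  simp only [Pi.sub_apply, Pi.add_apply, Pi.smul_apply, smul_eq_mul] at hp hq hr hs
  constructor
  · have : (θ'' p - θ'' q) - (θ p - θ q)
        = c p q * (θ'' p - θ'' q) * (u p - u q) + c r s * (θ'' r - θ'' s) * (w p - w q) := by linarith
    linear_combination (c p q) * this
  · have : (θ'' r - θ'' s) - (θ r - θ s)
        = c p q * (θ'' p - θ'' q) * (u r - u s) + c r s * (θ'' r - θ'' s) * (w r - w s) := by linarith
    linear_combination (c r s) * this

/-- ★★★ **THE N−2 FLOW CHANGE IS DRIVEN BY THE FICTITIOUS FLOWS**: for every ordered pair `(m,n)`,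
`c(m,n)[(θ''_m − θ''_n) − (θ_m − θ_n)] = D_{(mn),1}·f̃₁ + D_{(mn),2}·f̃₂` with `D_{(mn),1} = c(m,n)(u_m −
u_n)`, `D_{(mn),2} = c(m,n)(w_m − w_n)` the transfer factors of `(m,n)` for the two tripped lines.
[cite: GuoEtAl2020, §3.3.2 («`Δf_{−F} = K^F f_F`», Theorem 7, arXiv:2005.10199 p0009 L15–L48)] -/
theorem dcFlow_doubleOutage_flowChange (hc : IsConductance c) {G : SimpleGraph X}
    (hG : ∀ x y, G.Adj x y ↔ x ≠ y ∧ c x y ≠ 0) (hconn : G.Connected) {p q r s : X}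
    {L'' : Matrix X X ℝ}
    (hL'' : L'' = (Matrix.diagonal (nodeConductance c) - c)
        - c p q • Matrix.vecMulVec (Pi.single p (1 : ℝ) - Pi.single q 1) (Pi.single p (1 : ℝ) - Pi.single q 1)
        - c r s • Matrix.vecMulVec (Pi.single r (1 : ℝ) - Pi.single s 1) (Pi.single r (1 : ℝ) - Pi.single s 1))
    {P θ θ'' u w : X → ℝ} (hθ : (Matrix.diagonal (nodeConductance c) - c) *ᵥ θ = P)
    (hθ'' : L'' *ᵥ θ'' = P)
    (hu : (Matrix.diagonal (nodeConductance c) - c) *ᵥ u = Pi.single p 1 - Pi.single q 1)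
    (hw : (Matrix.diagonal (nodeConductance c) - c) *ᵥ w = Pi.single r 1 - Pi.single s 1) (m n : X) :
    c m n * ((θ'' m - θ'' n) - (θ m - θ n))
      = (c m n * (u m - u n)) * (c p q * (θ'' p - θ'' q))
        + (c m n * (w m - w n)) * (c r s * (θ'' r - θ'' s)) := by
  have h1 := dcFlow_doubleOutage_transfer hL'' hθ hθ''
  have h2 : (Matrix.diagonal (nodeConductance c) - c) *ᵥ (θ'' - θ)
      = (Matrix.diagonal (nodeConductance c) - c) *ᵥ
          ((c p q * (θ'' p - θ'' q)) • u + (c r s * (θ'' r - θ'' s)) • w) := by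
    rw [Matrix.mulVec_add, Matrix.mulVec_smul, Matrix.mulVec_smul, hu, hw, h1]
  obtain ⟨κ, hκ⟩ := (laplacian_mulVec_eq_mulVec_iff hc hG hconn _ _).1 h2.symm
  have hm := hκ m
  have hn := hκ n
  simp only [Pi.sub_apply, Pi.add_apply, Pi.smul_apply, smul_eq_mul] at hm hn
  have : (θ'' m - θ'' n) - (θ m - θ n)
      = c p q * (θ'' p - θ'' q) * (u m - u n) + c r s * (θ'' r - θ'' s) * (w m - w n) := by linarith
  rw [this]
  ring

/-- ★★★ **THE GENERALISED LODF FOR A DOUBLE OUTAGE, DIVISION-FREE (CRAMER)**: with `det = (1 −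
D₁₁)(1 − D₂₂) − D₁₂D₂₁`:
`det·f̃₁ = (1 − D₂₂)f₁ + D₁₂f₂`, `det·f̃₂ = D₂₁f₁ + (1 − D₁₁)f₂`, and for every ordered pair `(m,n)`
`det·ΔF_mn = D_{(mn),1}[(1 − D₂₂)f₁ + D₁₂f₂] + D_{(mn),2}[D₂₁f₁ + (1 − D₁₁)f₂]`
— `Δf_{−F} = D_{−FF}(I − D_{FF})⁻¹f_F` with the adjugate written out («`f̃_l − f_l = K^F_{l l₁}f_{l₁} +
K^F_{l l₂}f_{l₂}`»; no non-cut hypothesis is needed in this multiplied form).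
[cite: GuoEtAl2020, §3.3.2 Theorem 7 eq. `K^F = D_{−FF}(I − D_{FF})⁻¹` and Example 1 (arXiv:2005.10199 p0009 L42–L48, p0012 L80–L90); RonellenfitschEtAl2017, §5.2 (two failing lines, arXiv:1606.07276 p0008 L18–L24)] -/
theorem dcFlow_doubleOutage_glodf (hc : IsConductance c) {G : SimpleGraph X}
    (hG : ∀ x y, G.Adj x y ↔ x ≠ y ∧ c x y ≠ 0) (hconn : G.Connected) {p q r s : X}
    {L'' : Matrix X X ℝ}
    (hL'' : L'' = (Matrix.diagonal (nodeConductance c) - c)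
        - c p q • Matrix.vecMulVec (Pi.single p (1 : ℝ) - Pi.single q 1) (Pi.single p (1 : ℝ) - Pi.single q 1)
        - c r s • Matrix.vecMulVec (Pi.single r (1 : ℝ) - Pi.single s 1) (Pi.single r (1 : ℝ) - Pi.single s 1))
    {P θ θ'' u w : X → ℝ} (hθ : (Matrix.diagonal (nodeConductance c) - c) *ᵥ θ = P)
    (hθ'' : L'' *ᵥ θ'' = P)
    (hu : (Matrix.diagonal (nodeConductance c) - c) *ᵥ u = Pi.single p 1 - Pi.single q 1)
    (hw : (Matrix.diagonal (nodeConductance c) - c) *ᵥ w = Pi.single r 1 - Pi.single s 1) :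
    ((1 - c p q * (u p - u q)) * (1 - c r s * (w r - w s)) - (c p q * (w p - w q)) * (c r s * (u r - u s)))
        * (c p q * (θ'' p - θ'' q))
      = (1 - c r s * (w r - w s)) * (c p q * (θ p - θ q)) + (c p q * (w p - w q)) * (c r s * (θ r - θ s))
    ∧ ((1 - c p q * (u p - u q)) * (1 - c r s * (w r - w s)) - (c p q * (w p - w q)) * (c r s * (u r - u s)))
        * (c r s * (θ'' r - θ'' s))
      = (c r s * (u r - u s)) * (c p q * (θ p - θ q)) + (1 - c p q * (u p - u q)) * (c r s * (θ r - θ s))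
    ∧ ∀ m n : X,
      ((1 - c p q * (u p - u q)) * (1 - c r s * (w r - w s)) - (c p q * (w p - w q)) * (c r s * (u r - u s)))
          * (c m n * ((θ'' m - θ'' n) - (θ m - θ n)))
        = (c m n * (u m - u n))
            * ((1 - c r s * (w r - w s)) * (c p q * (θ p - θ q)) + (c p q * (w p - w q)) * (c r s * (θ r - θ s)))
          + (c m n * (w m - w n))
            * ((c r s * (u r - u s)) * (c p q * (θ p - θ q)) + (1 - c p q * (u p - u q)) * (c r s * (θ r - θ s))) := by
  obtain ⟨h1, h2⟩ := dcFlow_doubleOutage_selfConsistency hc hG hconn hL'' hθ hθ'' hu hw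
  have hf1 : ((1 - c p q * (u p - u q)) * (1 - c r s * (w r - w s)) - (c p q * (w p - w q)) * (c r s * (u r - u s)))
        * (c p q * (θ'' p - θ'' q))
      = (1 - c r s * (w r - w s)) * (c p q * (θ p - θ q)) + (c p q * (w p - w q)) * (c r s * (θ r - θ s)) := by
    rw [← h1, ← h2]; ring
  have hf2 : ((1 - c p q * (u p - u q)) * (1 - c r s * (w r - w s)) - (c p q * (w p - w q)) * (c r s * (u r - u s)))
        * (c r s * (θ'' r - θ'' s))
      = (c r s * (u r - u s)) * (c p q * (θ p - θ q)) + (1 - c p q * (u p - u q)) * (c r s * (θ r - θ s)) := by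
    rw [← h1, ← h2]; ring
  refine ⟨hf1, hf2, fun m n => ?_⟩
  rw [dcFlow_doubleOutage_flowChange hc hG hconn hL'' hθ hθ'' hu hw m n, ← hf1, ← hf2]
  ring

/-- ★★ **THE POST-CONTINGENCY OPERATING POINT EXISTS** (and is unique up to the slack angle) when the
surviving graph is connected («Suppose a non-cut set `F ⊊ E` of lines trip simultaneously so that the
surviving graph `(N, E∖F)` remains connected»).
[cite: GuoEtAl2020, §3.3.2 Theorem 7 hypothesis (arXiv:2005.10199 p0009 L34), §2 (DC model solvability)] -/
theorem exists_dcFlow_doubleOutage (hc : IsConductance c) {p q r s : X} (hpq : p ≠ q) (hrs : r ≠ s)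
    {c₁ : Matrix X X ℝ} (h₁pq : c₁ p q = 0) (h₁qp : c₁ q p = 0)
    (hoff₁ : ∀ x y, ¬ (x = p ∧ y = q) → ¬ (x = q ∧ y = p) → c₁ x y = c x y)
    {G₁ : SimpleGraph X} (hG₁ : ∀ x y, G₁.Adj x y ↔ x ≠ y ∧ c₁ x y ≠ 0)
    {c₂ : Matrix X X ℝ} (h₂rs : c₂ r s = 0) (h₂sr : c₂ s r = 0)
    (hoff₂ : ∀ x y, ¬ (x = r ∧ y = s) → ¬ (x = s ∧ y = r) → c₂ x y = c₁ x y)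
    {G₂ : SimpleGraph X} (hG₂ : ∀ x y, G₂.Adj x y ↔ x ≠ y ∧ c₂ x y ≠ 0) (hconn₂ : G₂.Connected)
    {P θ : X → ℝ} (hθ : (Matrix.diagonal (nodeConductance c) - c) *ᵥ θ = P) :
    (∃ θ'' : X → ℝ, (Matrix.diagonal (nodeConductance c₂) - c₂) *ᵥ θ'' = P)
    ∧ ∀ θ₁ θ₂ : X → ℝ, (Matrix.diagonal (nodeConductance c₂) - c₂) *ᵥ θ₁ = P →
        (Matrix.diagonal (nodeConductance c₂) - c₂) *ᵥ θ₂ = P → ∃ κ : ℝ, ∀ x, θ₂ x = θ₁ x + κ := by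
  obtain ⟨hle, -⟩ := surviving_sub₁₈ h₂rs h₂sr hoff₂ hG₁ hG₂
  have hconn₁ : G₁.Connected := hconn₂.mono hle
  have hc₁ := isConductance_lineOutage hc hpq h₁pq h₁qp hoff₁ hG₁ hconn₁
  have hc₂ := isConductance_lineOutage hc₁ hrs h₂rs h₂sr hoff₂ hG₂ hconn₂
  have hP : ∑ x, P x = 0 := by rw [← hθ]; exact sum_laplacian_mulVec_eq_zero hc θ
  refine ⟨exists_laplacian_mulVec_eq_of_sum_eq_zero hc₂ hG₂ hconn₂ hP, fun θ₁ θ₂ h₁ h₂ => ?_⟩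
  exact (laplacian_mulVec_eq_mulVec_iff hc₂ hG₂ hconn₂ θ₁ θ₂).1 (by rw [h₁, h₂])

/-- ★★★ **N−2 REDISTRIBUTION FOR THE DC MODEL, ASSEMBLED.**  Connected lossless grid `c`, distinct
lines `ℓ₁ = {p,q}`, `ℓ₂ = {r,s}` (`b₁ = c(p,q) > 0`, `b₂ = c(r,s) > 0`) tripped simultaneously, damaged
grids `c₁ = c − ℓ₁`, `c₂ = c₁ − ℓ₂` with the surviving graph `G₂` connected, `u`, `w` transfer potentials
of the intact grid for `ℓ₁`, `ℓ₂`.  Then for every pre-contingency operating point `Lθ = P`: (i) `det =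
(1 − D₁₁)(1 − D₂₂) − D₁₂D₂₁ > 0`; (ii) a post-contingency operating point `L₂θ'' = P` exists; (iii) for
EVERY such `θ''` and every ordered pair `(m,n)`, the flow change `ΔF_mn = c(m,n)[(θ''_m − θ''_n) − (θ_m −
θ_n)]` equals `K_{(mn),1}·f₁ + K_{(mn),2}·f₂` with `f₁ = c(p,q)(θ_p − θ_q)`, `f₂ = c(r,s)(θ_r − θ_s)` and
`K_{(mn),1} = [D_{(mn),1}(1 − D₂₂) + D_{(mn),2}D₂₁]/det`, `K_{(mn),2} = [D_{(mn),1}D₁₂ + D_{(mn),2}(1 −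
D₁₁)]/det` — the `2 × 2` case of `K^F = D_{−FF}(I − D_{FF})⁻¹`.  THREE COLUMNS: CERTIFIED = this
kernel identity for exact data; MODELLED = DC power flow, fixed injections, two simultaneous deletions,
surviving graph connected; VALIDATED = nothing numerical here.
[cite: GuoEtAl2020, §3.3.2 Theorem 7 and Example 1 (arXiv:2005.10199 p0009 L32–L65, p0012 L80–L90); RonellenfitschEtAl2017, §5.2 (arXiv:1606.07276 p0008 L18–L24)] -/
theorem dcFlow_doubleOutage (hc : IsConductance c) {G : SimpleGraph X}
    (hG : ∀ x y, G.Adj x y ↔ x ≠ y ∧ c x y ≠ 0) (hconn : G.Connected) {p q r s : X} (hpq : p ≠ q)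
    (hcpq : c p q ≠ 0) (hrs : r ≠ s) (hcrs : c r s ≠ 0) (hne : s(r, s) ≠ s(p, q))
    {c₁ : Matrix X X ℝ} (h₁pq : c₁ p q = 0) (h₁qp : c₁ q p = 0)
    (hoff₁ : ∀ x y, ¬ (x = p ∧ y = q) → ¬ (x = q ∧ y = p) → c₁ x y = c x y)
    {G₁ : SimpleGraph X} (hG₁ : ∀ x y, G₁.Adj x y ↔ x ≠ y ∧ c₁ x y ≠ 0)
    {c₂ : Matrix X X ℝ} (h₂rs : c₂ r s = 0) (h₂sr : c₂ s r = 0)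
    (hoff₂ : ∀ x y, ¬ (x = r ∧ y = s) → ¬ (x = s ∧ y = r) → c₂ x y = c₁ x y)
    {G₂ : SimpleGraph X} (hG₂ : ∀ x y, G₂.Adj x y ↔ x ≠ y ∧ c₂ x y ≠ 0) (hconn₂ : G₂.Connected)
    {u w : X → ℝ}
    (hu : (Matrix.diagonal (nodeConductance c) - c) *ᵥ u = Pi.single p 1 - Pi.single q 1)
    (hw : (Matrix.diagonal (nodeConductance c) - c) *ᵥ w = Pi.single r 1 - Pi.single s 1)
    {P θ : X → ℝ} (hθ : (Matrix.diagonal (nodeConductance c) - c) *ᵥ θ = P) :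
    0 < (1 - c p q * (u p - u q)) * (1 - c r s * (w r - w s)) - (c p q * (w p - w q)) * (c r s * (u r - u s))
    ∧ (∃ θ'' : X → ℝ, (Matrix.diagonal (nodeConductance c₂) - c₂) *ᵥ θ'' = P)
    ∧ ∀ θ'' : X → ℝ, (Matrix.diagonal (nodeConductance c₂) - c₂) *ᵥ θ'' = P → ∀ m n : X,
        c m n * ((θ'' m - θ'' n) - (θ m - θ n))
          = ((c m n * (u m - u n)) * (1 - c r s * (w r - w s)) + (c m n * (w m - w n)) * (c r s * (u r - u s)))
              / ((1 - c p q * (u p - u q)) * (1 - c r s * (w r - w s))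
                  - (c p q * (w p - w q)) * (c r s * (u r - u s)))
              * (c p q * (θ p - θ q))
            + ((c m n * (u m - u n)) * (c p q * (w p - w q)) + (c m n * (w m - w n)) * (1 - c p q * (u p - u q)))
              / ((1 - c p q * (u p - u q)) * (1 - c r s * (w r - w s))
                  - (c p q * (w p - w q)) * (c r s * (u r - u s)))
              * (c r s * (θ r - θ s)) := by
  obtain ⟨hle, -⟩ := surviving_sub₁₈ h₂rs h₂sr hoff₂ hG₁ hG₂
  have hconn₁ : G₁.Connected := hconn₂.mono hle
  have hdet := doubleOutage_det_pos hc hG hconn hpq hcpq hrs hcrs hne h₁pq h₁qp hoff₁ hG₁ h₂rs h₂sr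
    hoff₂ hG₂ hconn₂ hu hw
  have hL'' := laplacian_doubleOutage_eq hc hpq hrs hne h₁pq h₁qp hoff₁ hG₁ hconn₁ h₂rs h₂sr hoff₂
  refine ⟨hdet, (exists_dcFlow_doubleOutage hc hpq hrs h₁pq h₁qp hoff₁ hG₁ h₂rs h₂sr hoff₂ hG₂
    hconn₂ hθ).1, fun θ'' hθ'' m n => ?_⟩
  obtain ⟨-, -, h3⟩ := dcFlow_doubleOutage_glodf hc hG hconn hL'' hθ hθ'' hu hw
  have h := h3 m n
  rw [div_mul_eq_mul_div, div_mul_eq_mul_div, ← add_div, eq_div_iff hdet.ne']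
  linear_combination h

end ClassicalModel

end Literature.MathematicalPhysics.PowerSystems

end
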